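import Literature.NumberTheory.Transcendental.ExpDominantSolvabilityContraction
import Literature.NumberTheory.Transcendental.ExpVarieties
import Literature.ModelTheory.ExponentialFields.Languages
import Summits.Schanuel.Schanuel.Theorems.ZilberEacComplexPunctureDecouplingLemmas
import Summits.Schanuel.Schanuel.Theorems.ZilberEacComplexHypersurfaceEscapeLemmas
import HarnessLib

/-!
# EC by linear escape over an ARBITRARY hypersurface base

Zilber's Exponential-Algebraic Closedness, range `dim π₁(V) = n - 1` (first open rung, Mantova–Masser,
PLMS 129 (2024), §1 p. 5), for the `n`-folds with an ARBITRARY hypersurface base `B = {H = 0} ⊆ ℂⁿ`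
and rationally parametrised fibres of escape type,
`V = closure {(x, y) : H(x) = 0, yᵢ = cᵢ t^{νᵢ} + Σ_{m ∈ Sᵢ, m < νᵢ} A_{i,m}(x) tᵐ (t ∈ ℂˣ)}`
(`ν ∈ ℤⁿ` the direction of the fibre branch at `t = ∞`, `cᵢ ≠ 0`, `A_{i,m} ∈ ℂ[x]` arbitrary, Laurent
tails allowed). The packet's earlier base classes were graphs `xₙ = g(x')`, cyclic covers and spheres;
"non-cyclic hypersurface bases H(x', xₙ) = 0" was listed OPEN in its census.

LINEAR ESCAPE. Along `x = L ν + 2πi m q + w` (`q ∈ ℤⁿ`, `m ∈ ℕ`, `w` bounded) one has `e^{xᵢ} = e^{Lνᵢ} e^{wᵢ}`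
and `H(x) = mᴰ H_D(v) + m^{D-1}(∇H_D(v)·u + H_{D-1}(v)) + O(m^{D-2})`, `v = λν + 2πiq`, `L = λm + O(1)`.
So if `λ` is a SIMPLE root of the lattice polynomial `p_q(λ) = H_D(λν + 2πiq)` (`p_q'(λ) = ∇H_D(v)·ν ≠ 0`)
with `Re λ > 0`, the base equation is solved by an `O(1/m)` correction of an explicit affine shift, and
the fibre equations `e^{ζᵢ} = 1 + Σ A e^{(m-νᵢ)L}/cᵢ` are exponentially close to trivial: the contraction
lemma `Literature.NumberTheory.Transcendental.ExpDominant.exists_exp_eq_one_add` in `n + 1` unknowns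
`(ζ, ω)`, `L = λm + η₀(ζ) + (e^ω - 1)`, closes. (By `q ↦ -q`, `λ ↦ -λ` roots come in pairs `±`; the
hypothesis fails only when every `p_q` has all its roots on the imaginary axis — the oscillatory
situation of this packet's Theorems O/R.)

* `tendsto_one_add_pow_mul_exp_neg_lin` — `(1 + m)ᴺ e^{-(ρm - B)} → 0`;
* `exists_expPoint_hypersurfaceEscape` — **EC for the class above** (Theorem H_esc).

HONEST FRAMING: a modest new sub-rung of EAC; nothing here bears on Schanuel's conjecture.
-/

noncomputable section

open Complex MvPolynomial Metric Set Filter Topology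

set_option linter.dupNamespace false

namespace Summit.Schanuel.Schanuel.Theorems

/-- `(1 + m)ᴺ e^{-(ρ m - B)} → 0` as `m → ∞` (`ρ > 0`). [folklore] -/
theorem tendsto_one_add_pow_mul_exp_neg_lin (N : ℕ) {ρ : ℝ} (hρ : 0 < ρ) (B : ℝ) :
    Tendsto (fun m : ℝ => (1 + m) ^ N * Real.exp (-(ρ * m - B))) atTop (𝓝 0) := by
  set K : ℝ := 1 + (12 * ρ)⁻¹ with hK
  have hK0 : 0 ≤ K := by positivity
  have h1 := (tendsto_one_add_pow_mul_exp_neg_div N).comp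
    (tendsto_id.const_mul_atTop (by positivity : (0 : ℝ) < 12 * ρ))
  have h2 : Tendsto (fun m : ℝ => K ^ N * Real.exp B *
      ((1 + 12 * ρ * m) ^ N * Real.exp (-(12 * ρ * m / 12)))) atTop (𝓝 0) := by
    have := h1.const_mul (K ^ N * Real.exp B); rwa [mul_zero] at this
  refine squeeze_zero_norm' ?_ h2
  filter_upwards [eventually_ge_atTop (0 : ℝ)] with m hm
  rw [Real.norm_of_nonneg (by positivity)]
  have e1 : 1 + m ≤ K * (1 + 12 * ρ * m) := by
    rw [hK]
    have : (12 * ρ)⁻¹ * (12 * ρ * m) = m := by field_simp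
    nlinarith [inv_nonneg.mpr (by positivity : (0 : ℝ) ≤ 12 * ρ)]
  have e2 : (1 + m) ^ N ≤ K ^ N * (1 + 12 * ρ * m) ^ N := by
    rw [← mul_pow]; exact pow_le_pow_left₀ (by positivity) e1 N
  have e3 : Real.exp (-(ρ * m - B)) = Real.exp B * Real.exp (-(12 * ρ * m / 12)) := by
    rw [← Real.exp_add]; ring_nf
  rw [e3]
  calc (1 + m) ^ N * (Real.exp B * Real.exp (-(12 * ρ * m / 12)))
      ≤ K ^ N * (1 + 12 * ρ * m) ^ N * (Real.exp B * Real.exp (-(12 * ρ * m / 12))) :=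
        mul_le_mul_of_nonneg_right e2 (by positivity)
    _ = K ^ N * Real.exp B * ((1 + 12 * ρ * m) ^ N * Real.exp (-(12 * ρ * m / 12))) := by ring

set_option maxHeartbeats 800000 in
/-- **EC by linear escape over an arbitrary hypersurface base (Theorem H_esc).** Let
`H ∈ ℂ[x₁..xₙ]` have total degree `D ≥ 1`, leading form `H_D` and next form `H_{D-1}`; let `ν, q ∈ ℤⁿ`
and `λ ∈ ℂ` with `Re λ > 0` be such that `v = λν + 2πiq` satisfies `H_D(v) = 0` and
`Σᵢ νᵢ ∂ᵢH_D(v) ≠ 0` (a simple root of `λ ↦ H_D(λν + 2πiq)`); let `cᵢ ≠ 0`, `Sᵢ ⊆ ℤ` finite with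
`m < νᵢ` for `m ∈ Sᵢ`, and `A_{i,m} ∈ ℂ[x]` arbitrary. Then there are `x ∈ ℂⁿ` with `H(x) = 0` and
`L ∈ ℂ` with `e^{xᵢ} = cᵢ e^{νᵢL} + Σ_{m ∈ Sᵢ} A_{i,m}(x) e^{mL}` for all `i`: the `n`-fold swept by the
Laurent-parametrised fibre curves `yᵢ = cᵢt^{νᵢ} + Σ A_{i,m}(x)tᵐ` over the hypersurface `H = 0`
(additive projection `B = {H = 0}`, `dim π₁ V = n - 1`: first open range of Exponential-Algebraic
Closedness, Mantova–Masser 2024 §1 p. 5) meets the graph of `exp` — for ANY hypersurface base. New.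
[cite: MantovaMasser2023, §1 p.5 (the open case dim π(V) = 2 in ℂ³×ℂˣ³)] -/
theorem exists_expPoint_hypersurfaceEscape {n : ℕ} (H : MvPolynomial (Fin n) ℂ)
    (hD : 1 ≤ H.totalDegree) (ν q : Fin n → ℤ) (lam : ℂ) (hre : 0 < lam.re)
    (hroot : eval (fun i => lam * (ν i : ℂ) + 2 * Real.pi * I * (q i : ℂ))
      (homogeneousComponent H.totalDegree H) = 0)
    (hβ : ∑ i, (ν i : ℂ) * eval (fun i => lam * (ν i : ℂ) + 2 * Real.pi * I * (q i : ℂ))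
      (pderiv i (homogeneousComponent H.totalDegree H)) ≠ 0)
    (c : Fin n → ℂ) (hc : ∀ i, c i ≠ 0) (S : Fin n → Finset ℤ) (hS : ∀ i, ∀ m ∈ S i, m < ν i)
    (A : Fin n → ℤ → MvPolynomial (Fin n) ℂ) :
    ∃ x : Fin n → ℂ, ∃ L : ℂ, eval x H = 0 ∧ ∀ i,
      exp (x i) = c i * exp ((ν i : ℂ) * L) + ∑ m ∈ S i, eval x (A i m) * exp ((m : ℂ) * L) := by
  classical
  set D := H.totalDegree with hDdef
  set v : Fin n → ℂ := fun i => lam * (ν i : ℂ) + 2 * Real.pi * I * (q i : ℂ) with hv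
  set HD := homogeneousComponent D H with hHD
  set gD : Fin n → ℂ := fun j => eval v (pderiv j HD) with hgD
  set β : ℂ := ∑ i, (ν i : ℂ) * gD i with hβdef
  have hβ0 : β ≠ 0 := hβ
  have hβpos : 0 < ‖β‖ := norm_pos_iff.mpr hβ0
  set h1 : ℂ := eval v (homogeneousComponent (D - 1) H) with hh1
  set ρ : ℝ := lam.re with hρ
  set ℓ : Fin n → ℂ := fun i => log (c i) with hℓ
  have hexpℓ : ∀ i, exp (ℓ i) = c i := fun i => Complex.exp_log (hc i)
  set νc : Fin n → ℂ := fun i => (ν i : ℂ) with hνc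
  obtain ⟨C2, hC20, N2, hC2⟩ := exists_norm_eval_ray_secondOrder_le H hD v
  have hgrowth := fun i m =>
    Literature.NumberTheory.Transcendental.HypersurfaceCover.exists_norm_eval_le_pow (A i m)
  choose CA hCA0 NA hCA using hgrowth
  set ε : ℝ := 1 / (16 * ((n : ℝ) + 2)) with hε
  have hεpos : 0 < ε := by positivity
  -- the explicit affine shift and the a-priori bounds
  set B0 : ℝ := ((∑ j, (‖ℓ‖ + 1) * ‖gD j‖) + ‖h1‖) * ‖β‖⁻¹ with hB0
  have hB00 : 0 ≤ B0 := by positivity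
  set U : ℝ := (B0 + 2) * ‖νc‖ + ‖ℓ‖ + 1 with hU
  have hU0 : 0 ≤ U := by positivity
  set Kx : ℝ := 1 + ‖v‖ + U with hKx
  set Ff : Fin n → ℝ → ℝ := fun i m =>
    (∑ m' ∈ S i, CA i m' * Kx ^ NA i m' * ((1 + m) ^ NA i m' * Real.exp (-(ρ * m - (B0 + 2))))) /
      ‖c i‖ with hFf
  set Fl : ℝ → ℝ := fun m => C2 * (1 + U) ^ N2 / ‖β‖ * m⁻¹ with hFl
  have hFft : ∀ i, Tendsto (Ff i) atTop (𝓝 0) := by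
    intro i
    have h := tendsto_finsetSum (S i) fun m' _ =>
      (tendsto_one_add_pow_mul_exp_neg_lin (NA i m') hre (B0 + 2)).const_mul (CA i m' * Kx ^ NA i m')
    simp only [mul_zero, Finset.sum_const_zero] at h
    have h3 := h.div_const ‖c i‖
    rwa [zero_div] at h3
  have hFlt : Tendsto Fl atTop (𝓝 0) := by
    have h := tendsto_inv_atTop_zero.const_mul (C2 * (1 + U) ^ N2 / ‖β‖)
    rwa [mul_zero] at h
  have hev : ∀ᶠ m : ℝ in atTop, ((∀ i, Ff i m ≤ ε) ∧ Fl m ≤ ε) ∧ (B0 + 3) / ρ ≤ m := by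
    refine ((eventually_all.2 fun i => ?_).and ?_).and (eventually_ge_atTop _)
    · exact (hFft i).eventually (ge_mem_nhds hεpos)
    · exact hFlt.eventually (ge_mem_nhds hεpos)
  obtain ⟨R, hR⟩ := Filter.eventually_atTop.mp hev
  obtain ⟨mN, hmN⟩ := exists_nat_ge (max R 1)
  set m : ℝ := (mN : ℝ) with hm
  obtain ⟨⟨hFε, hFlε⟩, hmB⟩ := hR m ((le_max_left _ _).trans hmN)
  have hm1 : 1 ≤ m := (le_max_right _ _).trans hmN
  have hmpos : 0 < m := by linarith
  have hρm : B0 + 3 ≤ ρ * m := by rw [div_le_iff₀ hre] at hmB; linarith [mul_comm m ρ]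
  have hmC : (m : ℂ) ≠ 0 := by exact_mod_cast hmpos.ne'
  have hmD : ((m : ℂ) ^ (D - 1) * β) ≠ 0 := mul_ne_zero (pow_ne_zero _ hmC) hβ0
  -- ### the maps of the fixed-point problem on `ℂ^{n+1} ∋ ξ = (ζ, ω)`
  set η₀f : (Fin (n + 1) → ℂ) → ℂ := fun ξ =>
    -((∑ j, (ℓ j + ξ (Fin.castSucc j)) * gD j) + h1) * β⁻¹ with hη₀f
  set Ef : (Fin (n + 1) → ℂ) → ℂ := fun ξ => exp (ξ (Fin.last n)) - 1 with hEf
  set Lf : (Fin (n + 1) → ℂ) → ℂ := fun ξ => lam * m + η₀f ξ + Ef ξ with hLf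
  set uf : (Fin (n + 1) → ℂ) → (Fin n → ℂ) := fun ξ j =>
    (η₀f ξ + Ef ξ) * νc j + ℓ j + ξ (Fin.castSucc j) with huf
  set xf : (Fin (n + 1) → ℂ) → (Fin n → ℂ) := fun ξ => (m : ℂ) • v + uf ξ with hxf
  set Gf : Fin n → (Fin (n + 1) → ℂ) → ℂ := fun i ξ =>
    (∑ m' ∈ S i, eval (xf ξ) (A i m') * exp (((m' : ℂ) - νc i) * Lf ξ)) * (c i)⁻¹ with hGf
  set Gl : (Fin (n + 1) → ℂ) → ℂ := fun ξ =>
    Ef ξ - eval (xf ξ) H * ((m : ℂ) ^ (D - 1) * β)⁻¹ with hGl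
  set G : Fin (n + 1) → (Fin (n + 1) → ℂ) → ℂ :=
    Fin.snoc (α := fun _ => (Fin (n + 1) → ℂ) → ℂ) Gf Gl with hG
  -- ### differentiability
  have hproj : ∀ j : Fin (n + 1), Differentiable ℂ (fun ξ : Fin (n + 1) → ℂ => ξ j) :=
    fun j => differentiable_apply j
  have hη₀_diff : Differentiable ℂ η₀f := by
    have h3 := fun j (_ : j ∈ (Finset.univ : Finset (Fin n))) =>
      ((hproj (Fin.castSucc j)).const_add (ℓ j)).mul_const (gD j)
    have h4 := (((Differentiable.fun_sum h3).add_const h1).neg).mul_const β⁻¹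
    exact h4
  have hEf_diff : Differentiable ℂ Ef := ((hproj (Fin.last n)).cexp).sub_const 1
  have hLf_diff : Differentiable ℂ Lf := (hη₀_diff.const_add _).add hEf_diff
  have hxf_diff : ∀ j, Differentiable ℂ fun ξ => xf ξ j := by
    intro j
    have h2 := ((((hη₀_diff.add hEf_diff).mul_const (νc j)).add_const (ℓ j)).add
      (hproj (Fin.castSucc j))).const_add ((m : ℂ) * v j)
    exact h2
  have heval_diff : ∀ p : MvPolynomial (Fin n) ℂ, Differentiable ℂ fun ξ => eval (xf ξ) p :=
    fun p ξ => DifferentiableAt.mvPolynomial_eval p fun i => (hxf_diff i) ξ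
  have hG_diff : ∀ j, Differentiable ℂ (G j) := by
    intro j
    refine Fin.lastCases ?_ (fun j => ?_) j
    · have h2 := hEf_diff.sub ((heval_diff H).mul_const ((m : ℂ) ^ (D - 1) * β)⁻¹)
      simp only [hG, Fin.snoc_last]
      exact h2
    · have h3 := fun m' (_ : m' ∈ S j) =>
        (heval_diff (A j m')).mul ((hLf_diff.const_mul ((m' : ℂ) - νc j)).cexp)
      have h4 := (Differentiable.fun_sum h3).mul_const (c j)⁻¹
      simp only [hG, Fin.snoc_castSucc]
      exact h4
  -- ### bounds on the unit polydisc
  have hball : ∀ ξ ∈ ball (0 : Fin (n + 1) → ℂ) 1, ∀ j, ‖ξ j‖ ≤ 1 := by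
    intro ξ hξ j
    rw [mem_ball, dist_zero_right] at hξ
    exact (norm_le_pi_norm ξ j).trans hξ.le
  have hη₀b : ∀ ξ ∈ ball (0 : Fin (n + 1) → ℂ) 1, ‖η₀f ξ‖ ≤ B0 := by
    intro ξ hξ
    simp only [hη₀f]
    rw [norm_mul, norm_neg, norm_inv, hB0]
    refine mul_le_mul_of_nonneg_right ?_ (by positivity)
    refine (norm_add_le _ _).trans (add_le_add ?_ le_rfl)
    refine (norm_sum_le _ _).trans (Finset.sum_le_sum fun j _ => ?_)
    rw [norm_mul]
    refine mul_le_mul_of_nonneg_right ?_ (norm_nonneg _)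
    exact (norm_add_le _ _).trans (add_le_add (norm_le_pi_norm ℓ j) (hball ξ hξ _))
  have hEb : ∀ ξ ∈ ball (0 : Fin (n + 1) → ℂ) 1, ‖Ef ξ‖ ≤ 2 := by
    intro ξ hξ
    have := Complex.norm_exp_sub_one_le (hball ξ hξ (Fin.last n))
    simp only [hEf]; linarith [hball ξ hξ (Fin.last n)]
  have hub : ∀ ξ ∈ ball (0 : Fin (n + 1) → ℂ) 1, ‖uf ξ‖ ≤ U := by
    intro ξ hξ
    rw [pi_norm_le_iff_of_nonneg hU0]
    intro j
    simp only [huf]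
    have e1 : ‖(η₀f ξ + Ef ξ) * νc j‖ ≤ (B0 + 2) * ‖νc‖ := by
      rw [norm_mul]
      exact mul_le_mul ((norm_add_le _ _).trans (add_le_add (hη₀b ξ hξ) (hEb ξ hξ)))
        (norm_le_pi_norm νc j) (norm_nonneg _) (by positivity)
    calc ‖(η₀f ξ + Ef ξ) * νc j + ℓ j + ξ (Fin.castSucc j)‖
        ≤ ‖(η₀f ξ + Ef ξ) * νc j‖ + ‖ℓ j‖ + ‖ξ (Fin.castSucc j)‖ := norm_add₃_le
      _ ≤ (B0 + 2) * ‖νc‖ + ‖ℓ‖ + 1 := by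
          linarith [norm_le_pi_norm ℓ j, hball ξ hξ (Fin.castSucc j)]
  have hLre : ∀ ξ ∈ ball (0 : Fin (n + 1) → ℂ) 1, ρ * m - (B0 + 2) ≤ (Lf ξ).re := by
    intro ξ hξ
    simp only [hLf, Complex.add_re]
    have e1 : (lam * (m : ℂ)).re = ρ * m := by simp [hρ]
    have e2 := (Complex.abs_re_le_norm (η₀f ξ)).trans (hη₀b ξ hξ)
    have e3 := (Complex.abs_re_le_norm (Ef ξ)).trans (hEb ξ hξ)
    rw [e1]
    linarith [(abs_le.mp e2).1, (abs_le.mp e3).1]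
  have hxb : ∀ ξ ∈ ball (0 : Fin (n + 1) → ℂ) 1, 1 + ‖xf ξ‖ ≤ Kx * (1 + m) := by
    intro ξ hξ
    have h1' : ‖xf ξ‖ ≤ m * ‖v‖ + ‖uf ξ‖ := by
      simp only [hxf]
      refine (norm_add_le _ _).trans (add_le_add ?_ le_rfl)
      rw [norm_smul, Complex.norm_real, Real.norm_of_nonneg hmpos.le]
    rw [hKx]
    nlinarith [hub ξ hξ, norm_nonneg v, norm_nonneg (uf ξ)]
  have hbound : ∀ j, ∀ ξ ∈ ball (0 : Fin (n + 1) → ℂ) 1, ‖G j ξ‖ ≤ ε := by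
    intro j ξ hξ
    have hxfe : xf ξ = (m : ℂ) • v + uf ξ := rfl
    refine Fin.lastCases ?_ (fun j => ?_) j
    · -- the base equation: second-order ray expansion at `v`
      simp only [hG, Fin.snoc_last, hGl]
      have hkey : (∑ j, uf ξ j * gD j) + h1 = Ef ξ * β := by
        have e1 : ∑ j, uf ξ j * gD j =
            (η₀f ξ + Ef ξ) * β + ∑ j, (ℓ j + ξ (Fin.castSucc j)) * gD j := by
          rw [hβdef, Finset.mul_sum, ← Finset.sum_add_distrib]
          refine Finset.sum_congr rfl fun j _ => ?_
          simp only [huf]; ring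
        have e2 : η₀f ξ * β = -((∑ j, (ℓ j + ξ (Fin.castSucc j)) * gD j) + h1) := by
          simp only [hη₀f]; rw [mul_assoc, inv_mul_cancel₀ hβ0, mul_one]
        rw [e1]; linear_combination e2
      have hray := hC2 (m : ℂ) (by rwa [Complex.norm_real, Real.norm_of_nonneg hmpos.le]) (uf ξ)
      rw [← hxfe, ← hHD, hroot, mul_zero, sub_zero, hkey, Complex.norm_real,
        Real.norm_of_nonneg hmpos.le] at hray
      have e3 : Ef ξ - eval (xf ξ) H * ((m : ℂ) ^ (D - 1) * β)⁻¹ =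
          -(eval (xf ξ) H - (m : ℂ) ^ (D - 1) * (Ef ξ * β)) * ((m : ℂ) ^ (D - 1) * β)⁻¹ := by
        field_simp
        ring
      rw [e3, norm_mul, norm_neg, norm_inv, norm_mul, norm_pow, Complex.norm_real,
        Real.norm_of_nonneg hmpos.le, ← div_eq_mul_inv, div_le_iff₀ (by positivity)]
      refine hray.trans ?_
      have e4 : (1 + ‖uf ξ‖) ^ N2 ≤ (1 + U) ^ N2 :=
        pow_le_pow_left₀ (by positivity) (by linarith [hub ξ hξ]) _
      have hFl' : Fl m * (m ^ (D - 1) * ‖β‖) = C2 * (1 + U) ^ N2 * m ^ (D - 1) / m := by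
        simp only [hFl]; field_simp
      calc C2 * (1 + ‖uf ξ‖) ^ N2 * m ^ (D - 1) / m ≤ C2 * (1 + U) ^ N2 * m ^ (D - 1) / m := by
            refine div_le_div_of_nonneg_right ?_ hmpos.le
            exact mul_le_mul_of_nonneg_right (mul_le_mul_of_nonneg_left e4 hC20) (by positivity)
        _ = Fl m * (m ^ (D - 1) * ‖β‖) := hFl'.symm
        _ ≤ ε * (m ^ (D - 1) * ‖β‖) := mul_le_mul_of_nonneg_right hFlε (by positivity)
    · -- the fibre coordinates
      simp only [hG, Fin.snoc_castSucc, hGf]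
      rw [norm_mul, norm_inv, ← div_eq_mul_inv]
      refine le_trans ?_ (hFε j)
      simp only [hFf]
      refine div_le_div_of_nonneg_right ?_ (norm_nonneg _)
      refine (norm_sum_le _ _).trans (Finset.sum_le_sum fun m' hm' => ?_)
      have hlt : (m' : ℝ) - (ν j : ℝ) ≤ -1 := by
        have := hS j m' hm'
        have : (m' : ℝ) + 1 ≤ (ν j : ℝ) := by exact_mod_cast this
        linarith
      rw [norm_mul]
      have f1 : ‖eval (xf ξ) (A j m')‖ ≤ CA j m' * Kx ^ NA j m' * (1 + m) ^ NA j m' := by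
        refine (hCA j m' (xf ξ)).trans ?_
        rw [mul_assoc, ← mul_pow]
        exact mul_le_mul_of_nonneg_left (pow_le_pow_left₀ (by positivity) (hxb ξ hξ) _) (hCA0 j m')
      have f2 : ‖exp (((m' : ℂ) - νc j) * Lf ξ)‖ ≤ Real.exp (-(ρ * m - (B0 + 2))) := by
        rw [Complex.norm_exp, Real.exp_le_exp]
        have hre' : (((m' : ℂ) - νc j) * Lf ξ).re = ((m' : ℝ) - (ν j : ℝ)) * (Lf ξ).re := by
          simp [hνc, Complex.mul_re]
        rw [hre']
        have hL := hLre ξ hξ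
        have hLpos : 0 ≤ (Lf ξ).re := by linarith
        nlinarith
      calc ‖eval (xf ξ) (A j m')‖ * ‖exp (((m' : ℂ) - νc j) * Lf ξ)‖
          ≤ (CA j m' * Kx ^ NA j m' * (1 + m) ^ NA j m') * Real.exp (-(ρ * m - (B0 + 2))) :=
            mul_le_mul f1 f2 (norm_nonneg _)
              (mul_nonneg (mul_nonneg (hCA0 j m') (pow_nonneg (by positivity) _))
                (pow_nonneg (by positivity) _))
        _ = CA j m' * Kx ^ NA j m' * ((1 + m) ^ NA j m' * Real.exp (-(ρ * m - (B0 + 2)))) := by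
            ring
  -- ### the fixed point and the exponential point
  have hε' : 16 * ((n + 1 : ℕ) + 1 : ℝ) * ε ≤ 1 := by
    rw [hε]; push_cast
    have : (16 : ℝ) * (n + 1 + 1) * (1 / (16 * (n + 2))) = 1 := by field_simp; ring
    rw [this]
  obtain ⟨ξ, hξ, hfix⟩ :=
    Literature.NumberTheory.Transcendental.ExpDominant.exists_exp_eq_one_add G hεpos.le hε'
      (fun j => (hG_diff j).differentiableOn) hbound
  refine ⟨xf ξ, Lf ξ, ?_, fun i => ?_⟩
  · have hlast := hfix (Fin.last n)
    simp only [hG, Fin.snoc_last, hGl, hEf] at hlast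
    have h0 : eval (xf ξ) H * ((m : ℂ) ^ (D - 1) * β)⁻¹ = 0 := by linear_combination hlast
    rcases mul_eq_zero.mp h0 with h | h
    · exact h
    · exact absurd h (inv_ne_zero hmD)
  · have hi := hfix (Fin.castSucc i)
    simp only [hG, Fin.snoc_castSucc, hGf] at hi
    have hxi : xf ξ i = Lf ξ * νc i + ℓ i + ξ (Fin.castSucc i) +
        ((mN * q i : ℤ) : ℂ) * (2 * Real.pi * I) := by
      simp only [hxf, huf, hLf, hv, hνc, hm, Pi.add_apply, Pi.smul_apply, smul_eq_mul]
      push_cast; ring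
    have hct : ∀ z : ℂ, c i * (z * (c i)⁻¹) = z := fun z => by
      rw [mul_comm z, ← mul_assoc, mul_inv_cancel₀ (hc i), one_mul]
    have hpow : ∀ m' : ℤ, exp (Lf ξ * νc i) * exp (((m' : ℂ) - νc i) * Lf ξ) = exp ((m' : ℂ) * Lf ξ) := by
      intro m'; rw [← Complex.exp_add]; congr 1; ring
    calc exp (xf ξ i) = exp (Lf ξ * νc i) * exp (ℓ i) * exp (ξ (Fin.castSucc i)) *
          exp (((mN * q i : ℤ) : ℂ) * (2 * Real.pi * I)) := by
          rw [hxi, Complex.exp_add, Complex.exp_add, Complex.exp_add]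
      _ = exp (Lf ξ * νc i) * (c i + ∑ m' ∈ S i,
            eval (xf ξ) (A i m') * exp (((m' : ℂ) - νc i) * Lf ξ)) := by
          rw [Complex.exp_int_mul_two_pi_mul_I, mul_one, hexpℓ, hi, mul_assoc, mul_add, mul_one, hct]
      _ = c i * exp ((ν i : ℂ) * Lf ξ) +
            ∑ m' ∈ S i, eval (xf ξ) (A i m') * exp ((m' : ℂ) * Lf ξ) := by
          rw [mul_add, Finset.mul_sum, hνc, mul_comm (Lf ξ)]
          congr 1
          · ring
          · refine Finset.sum_congr rfl fun m' _ => ?_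
            rw [← hpow m', hνc]; ring

end Summit.Schanuel.Schanuel.Theorems
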